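import Literature.RingTheory.Valuation.IntegralPointsSpecialisationCount
import Mathlib.FieldTheory.IsAlgClosed.Basic
import Mathlib.RingTheory.Flat.FaithfullyFlat.Basic
import Mathlib.RingTheory.LocalRing.Module
import HarnessLib

/-!
# Over the valuation ring of an algebraically closed field, every point of the special fibre of a finite flat algebra is the specialisation
# of an integral point ([SerreTate1968] §1 Lemma 1 — «`A(K̄) → A(k̄)` … surjective», the finite-level mechanism; [StacksProject] Tag 04GG)

Topic `Literature/RingTheory/Valuation`, namespace `ValuationSubring`.  THEOREMS ONLY (no definition, no named fact, no instance, no notation,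
no `sorry`).  Sequel of ★ `Valuation/IntegralPointsSpecialisationCount` (which COUNTS the integral points with prescribed specialisation when the
generic fibre is reduced); here only EXISTENCE is proved, with NO reducedness: `V ⊆ Ω` the valuation ring of an ALGEBRAICALLY CLOSED field,
`B` a module-finite FLAT `V`-algebra, `χ : B → κ(V)` a ring map under `V` ⟹ there is a `V`-algebra map `ψ : B → V` with `residue ∘ ψ = χ`.
Mechanism: `B` is free (Mathlib `Module.free_of_flat_of_isLocalRing`, [StacksProject] Tag 00NZ); the corner `B_I = B ⧸ (1 - e_I)` of `χ`
(★ `exists_corner_of_ringHom`: `V` is henselian, [StacksProject] Tag 04GG) is local, finite free and non-zero, so `Ω ⊗_V B_I ≠ 0`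
(faithful flatness) has an `Ω`-point (`Ω` algebraically closed, Mathlib `IsAlgClosed.lift` on a residue field of `Ω ⊗_V B_I`), which is
INTEGRAL, hence a `V`-point of `B_I` (★ `ValuationSubring.exists_algHom_equiv_algHom`), i.e. a `V`-point `ψ` of `B` with `ψ(e_I) = 1`, and
`ψ(e_I) = 1 ⟺ residue ∘ ψ = χ` (★ `apply_sub_one_mem_iff_ker_eq_comap`, ★ `residue_comp_eq_iff_ker_eq`).  Cell `pub/hodgecm-mathlib`
(D-0151 ∕ D-0183 floor 0), P6 «MOD», sub-line P6b `Cruxes/HLiu418/Lines/F0_P6b_ConnectedEtale.lean` ED. 1, stub `stub_b1d_reductionSurjective`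
(its algebra core; the scheme shell is the Summits-side closer); generic capital `--supports stmt-HodgeConjecture-24832`.  HONEST LABEL: HC_CM is
proved only modulo the cell's 2 remaining named inputs (hLiu418 24832, h413 24833) until rung 0 closes; this file pays no letter.

* `exists_algHom_of_nontrivial_of_isAlgClosed` — a non-trivial commutative algebra, module-finite over an algebraically closed field `Ω`, has
  an `Ω`-algebra map to `Ω` (a maximal ideal has residue field algebraic over `Ω`, hence `= Ω`);
* `exists_algHom_apply_eq_one` — for `B` finite free over `V` and a non-trivial corner `B ⧸ (1 - e)` (`e` idempotent): a `V`-point `ψ` of `B`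
  with `ψ e = 1`;
* **`exists_algHom_residue_comp_eq`** — the head displayed above.

## References
* [SerreTate1968] J.-P. Serre, J. Tate, *Good reduction of abelian varieties*, Ann. of Math. 88 (1968), §1, Lemma 1 and the reduction map
  (surjectivity of `A(K̄) → Ã(k̄)` on torsion of order prime to nothing here — the finite flat level).
* [StacksProject] The Stacks Project, Tag 04GG (finite algebras over henselian local rings are products of local rings), Tag 00NZ (finite flat
  over local is free), Tag 00U3.
-/

set_option autoImplicit false

open IsLocalRing
open scoped TensorProduct

namespace ValuationSubring

/-- **A non-trivial commutative algebra which is module-finite over an algebraically closed field `Ω` has an `Ω`-point** (`D ⧸ 𝔪` is a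
finite, hence algebraic, field extension of `Ω`, so `Ω`; Mathlib `IsAlgClosed.lift`). [cite: StacksProject, Tag 00U3] -/
theorem exists_algHom_of_nontrivial_of_isAlgClosed (Ω : Type*) [Field Ω] [IsAlgClosed Ω] (D : Type*) [CommRing D] [Algebra Ω D]
    [Module.Finite Ω D] [Nontrivial D] : Nonempty (D →ₐ[Ω] Ω) := by
  obtain ⟨M, hM⟩ := Ideal.exists_maximal D
  letI : Field (D ⧸ M) := Ideal.Quotient.field M
  haveI : Algebra.IsIntegral Ω (D ⧸ M) := Algebra.IsIntegral.of_finite Ω (D ⧸ M)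
  exact ⟨(IsAlgClosed.lift : (D ⧸ M) →ₐ[Ω] Ω).comp (Ideal.Quotient.mkₐ Ω M)⟩

variable {Ω : Type} [Field Ω] [IsAlgClosed Ω] (V : ValuationSubring Ω) {B : Type} [CommRing B] [Algebra V B] [Module.Finite V B]

/-- **A non-trivial corner of a finite free `V`-algebra has a `V`-point**: for `e` idempotent with `B ⧸ (1 - e)` non-trivial there is
`ψ : B →ₐ[V] V` with `ψ e = 1`.  The corner is finite free (★ `free_quotient_span_one_sub`) and non-zero, hence faithfully flat, so
`Ω ⊗_V (B ⧸ (1 - e)) ≠ 0` has an `Ω`-point, which is integral over `V`, hence `V`-valued (★ `exists_algHom_equiv_algHom`).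
[cite: StacksProject, Tag 04GG] [cite: StacksProject, Tag 00U3] -/
theorem exists_algHom_apply_eq_one [Module.Free V B] {e : B} (he : IsIdempotentElem e)
    [Nontrivial (B ⧸ Ideal.span {1 - e})] : ∃ ψ : B →ₐ[↥V] ↥V, ψ e = 1 := by
  haveI : Module.Free (↥V) (B ⧸ Ideal.span {1 - e}) :=
    Literature.RingTheory.Idempotents.free_quotient_span_one_sub (R := ↥V) he
  haveI : Module.FaithfullyFlat (↥V) (B ⧸ Ideal.span {1 - e}) := inferInstance
  haveI : Nontrivial (Ω ⊗[↥V] (B ⧸ Ideal.span {1 - e})) :=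
    Module.FaithfullyFlat.rTensor_nontrivial (↥V) (B ⧸ Ideal.span {1 - e}) Ω
  obtain ⟨φΩ⟩ := exists_algHom_of_nontrivial_of_isAlgClosed Ω (Ω ⊗[↥V] (B ⧸ Ideal.span {1 - e}))
  let φ : (B ⧸ Ideal.span {1 - e}) →ₐ[↥V] Ω :=
    (φΩ.restrictScalars ↥V).comp Algebra.TensorProduct.includeRight
  haveI : Algebra.IsIntegral (↥V) (B ⧸ Ideal.span {1 - e}) := Algebra.IsIntegral.of_finite _ _
  obtain ⟨eqv, -⟩ := V.exists_algHom_equiv_algHom (C := B ⧸ Ideal.span {1 - e})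
  let ψ₀ : (B ⧸ Ideal.span {1 - e}) →ₐ[↥V] ↥V := eqv.symm φ
  refine ⟨ψ₀.comp (Ideal.Quotient.mkₐ (↥V) (Ideal.span {1 - e})), ?_⟩
  have h0 : Ideal.Quotient.mkₐ (↥V) (Ideal.span {1 - e}) (1 - e) = 0 :=
    Ideal.Quotient.eq_zero_iff_mem.mpr (Ideal.subset_span rfl)
  have h1 : ψ₀ (Ideal.Quotient.mkₐ (↥V) (Ideal.span {1 - e}) e) = 1 := by
    have := congrArg ψ₀ h0
    rw [map_sub, map_one, map_sub, map_one, map_zero, sub_eq_zero] at this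
    exact this.symm
  exact h1

/-- **Every point of the special fibre of a finite FLAT algebra over the valuation ring of an algebraically closed field is the specialisation
of an integral point**: for `χ : B → κ(V)` a ring map under `V` there is `ψ : B →ₐ[V] V` with `residue ∘ ψ = χ`.  (`B` is free by
[StacksProject] Tag 00NZ; corner of `χ` by ★ `exists_corner_of_ringHom`; a `V`-point of the corner by `exists_algHom_apply_eq_one`; it
specialises to `χ` by ★ `apply_sub_one_mem_iff_ker_eq_comap` + ★ `residue_comp_eq_iff_ker_eq`.)  FALSE without flatness (`B = κ(V)`).
[cite: SerreTate1968, §1 Lemma 1] [cite: StacksProject, Tag 04GG] -/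
theorem exists_algHom_residue_comp_eq [Module.Flat V B] (χ : B →+* ResidueField V) (hχ : χ.comp (algebraMap V B) = residue V) :
    ∃ ψ : B →ₐ[↥V] ↥V, (residue ↥V).comp (ψ : B →+* ↥V) = χ := by
  classical
  haveI : Module.Free (↥V) B := Module.free_of_flat_of_isLocalRing
  obtain ⟨_, e, I, he, hsep1, hsep0, hloc, hI⟩ := exists_corner_of_ringHom V χ hχ
  haveI : Nontrivial (B ⧸ Ideal.span {1 - e I}) := (hloc I).toNontrivial
  obtain ⟨ψ, hψ⟩ := exists_algHom_apply_eq_one V (he.idem I)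
  refine ⟨ψ, ?_⟩
  let χ' : B →ₐ[↥V] ResidueField ↥V := AlgHom.mk χ fun r => RingHom.congr_fun hχ r
  change (residue ↥V).comp (ψ : B →+* ↥V) = (χ' : B →+* ResidueField ↥V)
  rw [IsLocalRing.residue_comp_eq_iff_ker_eq, show RingHom.ker (χ' : B →+* ResidueField ↥V) = _ from hI,
    ← Literature.RingTheory.Idempotents.apply_sub_one_mem_iff_ker_eq_comap e hsep1 hsep0 ψ I, hψ, sub_self]
  exact (maximalIdeal ↥V).zero_mem

end ValuationSubring
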